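import Summits.Ventures.HSemireg.AmplificationChainG4Transport
import Summits.Ventures.HSemireg.AmplificationChainPridhamPerfect
import Summits.Ventures.HSemireg.PerfectComplexChartSpread
import Summits.Ventures.HSemireg.PerfectComplexSigmaDoor
import HarnessLib

/-!
# Venture HSemireg — route (C) at g = 4, σ-TIER at the printed étale shape, with the `Ext`-vanishing / simplicity binders
# carried from the SOURCE SHEAF `I_Z` along a locally fully faithful functor (seat p6's transport × target seat 7's σ-door ×
# theory seat 3's étale assumption × seat p7's census-row theorem)

HONEST FRAMING. Lean index of the computation cell `pub-hsemireg` (seat p7, «assembly»). Nothing about any explicit variety is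
asserted; every published input is a hypothesis BY NAME; the object and its numbers are BY VALUE from the census. Nothing here says
HC, HC_CM or HC_AV is proved; the g = 4 split case is IN PRINT ([Markman2023GeneralizedKummers] Thm. 1.5 (= Thm. 13.4; J. Eur. Math. Soc. 25 (2023) p. 236; pre-publication arXiv numbering: Thm. 1.3)) and is RE-DERIVED modulo the
named hypotheses. Theorems only: 0 `def`, 0 `sorry`, no new named fact.

## What this file adds (one theorem and its functor-free form)

`AmplificationChainG4Etale.lean` §4 states the σ-certificate census row
`weilFourfoldsSplit_of_reach_of_sigmaDeformsOverEtaleNbhd_of_complex` with ALL `Ext` binders on the object `E` over the CM anchor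
`A₀ = P.X`: `hneg : Ext^{<0}(E,E) = 0`, `h0 : Hom(E,E) = ℂ` (`extRank`) and `hσ : (σ_q(E))_{q+1∈I}` jointly injective. The census
certifies `hσ` ON `E` itself (the `σ`-rank `18 = dim Ext²` of `𝓔 = Φ(I_Z) ⊗ M_B` on two codes) but certifies the `Ext` DIMENSIONS on the
SOURCE: (I1) `Ext^•(I_Z, I_Z) = (1, 8, 18, 8, 1)` are Künneth numbers of the ideal sheaf `I_Z` on `X × X`, moved to `𝓔` by Orlov's
equivalence composed with `⊗ M_B` (in print on `D^b(Coh)`: [Orlov2002DerivedAbelian] Assertion 2.8, [Mukai1981] Thm. 2.2; wording rule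
F-3, red-5: the kernel uses only bijectivity of `Φ.map` on the self-Homs of `Q I_Z[0]` in the degrees used). This file states the
σ-row with `hneg` DISCHARGED (the image of a sheaf has `Ext^{<0} = 0`, seat p6's `extRank_single_neg_eq_zero` + `extRank_eq_of_local_ff`)
and `h0` moved to the source (`extRank Y₀ I_Z[0] 0 = 1`, «`I_Z` simple»), `hσ` staying on `E` — i.e. every BY-VALUE binder sits exactly
where the census computed it. BY NAME: `weilFamilyReach_hyperbolic` (refereed) and the ONE assumption
`PerfectComplexDeformsOverEtaleNbhd C sigmaAdmissible` (printed OBJECT hypothesis — I-semiregular, `Ext^{<0} = 0`, simple: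
[BuchweitzFlenner2003] Thm. 5.1 / [Pridham2024Semiregularity] Cor. 2.25 + Rem. 2.27 / Perry 2026 Thm. 1.1 bullet 2, `B₀ = 0` — AND
printed CONCLUSION shape, [Perry2022] proof of Prop. 8.1; content on paper (L1)–(L6) of `theory/TH2-ASSEMBLY-NOTE-2PAGE.md` §3 + atlas +
étale quasi-section [EGAIV4] Cor. 17.16.3 (i) + strictification [ThomasonTrobaugh1990] 2.3.1 (d); NO [BuchweitzFlenner2008HH] 6.4.4 step;
THE KERNEL LINKS IT TO NOTHING — F-1). W-4 (red-5): target seat 7's `PerfectComplexSigmaTransfer C` is the CONSUMED `hT`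
(`hD ⟹ hT` kernel via theory seat 3's spread; `hT ⟹ hD` not claimed; `hD` is an assumption, never «the printed theorem»).

References: [Perry2022] proof of Prop. 8.1 · [Pridham2024Semiregularity] Cor. 2.25, Rem. 2.27 · [BuchweitzFlenner2003] Def. 4.1, §5 ·
[Lieblich2006] Thm. 4.2.1 · [Orlov2002DerivedAbelian] Assertion 2.8 · [Mukai1981] Thm. 2.2 · [GortzWedhorn2023] Thm. 22.42 ·
[Markman2023GeneralizedKummers] Thm. 1.5 (= Thm. 13.4; J. Eur. Math. Soc. 25 (2023) p. 236; pre-publication arXiv numbering: Thm. 1.3) (the case in print) · [Deligne1982HodgeCycles] proof of Thm. 4.8 (reach).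
-/

noncomputable section

open CategoryTheory AlgebraicGeometry Set
open Literature.AlgebraicGeometry.Motives Literature.AlgebraicGeometry.HodgeTheory
open Literature.AlgebraicGeometry.ModuliOfAbelianVarieties Literature.AlgebraicGeometry.Deligne1982
open Literature.AlgebraicGeometry.KTheory
open Literature.AlgebraicTopology.SingularHomology

namespace Summit.Ventures.HSemireg

open Summit.HodgeConjecture.HodgeConjecture
open Summit.HodgeConjecture.HodgeConjecture.WeilTypeLadder
open Summit.HodgeConjecture.HodgeConjecture.Cruxes.HodgeAbelianVarieties.EStepSecantInduction
open Summit.Ventures.HSemireg.GeneralStructure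

variable {C : ChernCharacterBetti}

/-- **g = 4, σ-TIER, printed transfer shape — FUNCTOR-FREE transport of the `Ext` clauses** (red-5 V16 pattern): the σ-certificate
census row with `hneg` / `h0` replaced by the same clauses for a complex `G` on another `ℂ`-scheme `Y₀` plus the bare equalities
`extRank P.X E n = extRank Y₀ G n` for `n ≤ 0` (the only degrees these two clauses use); `hσ` stays on `E`. BY NAME: reach and
`PerfectComplexDeformsOverEtaleNbhd C sigmaAdmissible` (ASSUMPTION, F-1 / W-4 as in the module docstring).
[cite: Markman2023GeneralizedKummers, Theorem 1.5 (= Theorem 13.4), p. 236 (the case in print; arXiv:1805.11574 pre-publication numbering: Theorem 1.3)] [cite: Perry2022, proof of Prop. 8.1]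
[cite: Pridham2024Semiregularity, Cor. 2.25, Rem. 2.27] [cite: BuchweitzFlenner2003, Def. 4.1 and §5 (I-semiregular)] -/
theorem weilFourfoldsSplit_of_reach_of_sigmaDeformsOverEtaleNbhd_of_extRank_eq (hF : weilFamilyReach_hyperbolic)
    (hD : PerfectComplexDeformsOverEtaleNbhd C sigmaAdmissible) {d : ℕ} (hd : 0 < d)
    (P : AbelianVariety ℂ) (ψ₀ : P ⟶ P) (e : ProjectiveEmbedding P.X) (a : complexBetti (projectiveSpace e.n ℂ) 2)
    (hP : P.dim = 2 * 2) (hψ : ψ₀ ≫ ψ₀ = -(d • 𝟙 P)) (ha : IsRationalClass a) (ha0 : a ≠ 0)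
    (hhyp : IsHyperbolicWeilType P ψ₀ 2 (symmetrisedClass d P ψ₀ e a))
    (w : complexBetti P.X (2 * 2)) (hwW : w ∈ weilClassesOf P ψ₀ 2 d) (hwr : IsRationalClass w) (hw0 : w ≠ 0)
    (I : Finset ℕ) (hI : ∀ p : ℕ, 1 ≤ p → p ≤ 2 * 2 → p ∈ I) (E : CochainComplex P.X.left.Modules ℤ)
    (hE : IsBoundedVBComplex E) (a' b' : ℤ) [E.IsStrictlyGE a'] [E.IsStrictlyLE b']
    (hσ : letI := HasDerivedCategory.standard P.X.left.Modules
      HomComplex.IsISemiregularC P.X E a' b' hE.isFiniteLocallyFree {q | q + 1 ∈ I})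
    (q : ℚ) (c : ℕ → ℚ)
    (hch2 : chPerfect C P.X E hE.isFiniteLocallyFree 2 = ((q : ℚ) : ℂ) • cupPowTwo (symmetrisedClass d P ψ₀ e a) 2 + w)
    (hchp : ∀ p ∈ I, p ≠ 2 →
      chPerfect C P.X E hE.isFiniteLocallyFree p = ((c p : ℚ) : ℂ) • cupPowTwo (symmetrisedClass d P ψ₀ e a) p)
    {Y₀ : SchemeOver ℂ} (G : CochainComplex Y₀.left.Modules ℤ)
    (hext : ∀ n : ℤ, n ≤ 0 → extRank P.X E n = extRank Y₀ G n)
    (hneg : ∀ k : ℤ, k < 0 → extRank Y₀ G k = 0) (h0 : extRank Y₀ G 0 = 1) :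
    Stubs.WeilAlgebraicSplitHyperplane 2 d :=
  weilFourfoldsSplit_of_reach_of_perfectComplexSigmaTransfer_of_complex hF
    ((perfectComplexSigmaTransfer_iff C).2 hD.perfectComplexVariationalHodge) hd P ψ₀ e a hP hψ ha ha0 hhyp w hwW hwr hw0 I hI E hE
    (fun k hk ↦ (hext k hk.le).trans (hneg k hk)) ((hext 0 le_rfl).trans h0) a' b' hσ q c hch2 hchp

/-- **g = 4, σ-TIER, printed transfer shape — THE σ-CERTIFICATE MONDAY FORM: SHEAF source, LOCAL full faithfulness, `σ` on the
object.** BY NAME: `weilFamilyReach_hyperbolic` (refereed) and the ONE ASSUMPTION `PerfectComplexDeformsOverEtaleNbhd C sigmaAdmissible`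
(printed object hypothesis AND printed conclusion shape; content on paper; kernel-linked to nothing, F-1; target seat 7's
`PerfectComplexSigmaTransfer C` consumed ⟸ `hD` assumed, W-4). BY VALUE, each binder where the census computed it: the split CM anchor
`(P, ψ₀, e, a)` and hyperbolicity (I4); `w ≠ 0` rational in the Weil plane and the Chern data `hch2 / hchp` (I3); `I ⊇ {1,2,3,4}`; the
bounded complex of vector bundles `E` on `P.X` in `[a', b']` (`𝓔 = Φ(I_Z) ⊗ M_B`, seat p6's existence files) with `(σ_q(E))_{q+1∈I}`
JOINTLY INJECTIVE (`hσ` — the census's «σ-rank = dim Ext² = 18, two codes»); a SHEAF `G₀` on `Y₀` (`I_Z` on `X × X`), a `ℂ`-linear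
additive shift-commuting `Φ : D(Mod 𝒪_{Y₀}) ⥤ D(Mod 𝒪_{P.X})` with `Φ(Q G₀[0]) ≅ Q E` and `Φ.map` BIJECTIVE on the self-Homs of `Q G₀[0]`
in degrees `n ≤ 0` (what Orlov's `D^b(Coh)` equivalence + [GortzWedhorn2023] Thm. 22.42 give for coherent `G₀`; F-3) and
`extRank Y₀ G₀[0] 0 = 1` («`I_Z` simple», (I1)); `Ext^{<0} = 0` DISCHARGED for a sheaf source (seat p6). Conclusion:
`Stubs.WeilAlgebraicSplitHyperplane 2 d` — the Weil classes of EVERY abelian fourfold of the split `ℚ(√-d)`-Weil component are algebraic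
(in print: [Markman2023GeneralizedKummers] Thm. 1.5 (= Thm. 13.4; J. Eur. Math. Soc. 25 (2023) p. 236; pre-publication arXiv numbering: Thm. 1.3); re-derived, no new case). No `rank Ext² ≤ r` binder and no
[BuchweitzFlenner2008HH] 6.4.4 step occur in this form. [cite: Markman2023GeneralizedKummers, Theorem 1.5 (= Theorem 13.4), p. 236 (the case in print; arXiv:1805.11574 pre-publication numbering: Theorem 1.3)]
[cite: Perry2022, proof of Prop. 8.1] [cite: Pridham2024Semiregularity, Cor. 2.25, Rem. 2.27]
[cite: BuchweitzFlenner2003, Def. 4.1 and §5 (I-semiregular)] [cite: Orlov2002DerivedAbelian, Assertion 2.8]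
[cite: GortzWedhorn2023, Thm. 22.42] [cite: Lieblich2006, Prop. 2.1.9] [claim: Perry2026Semiregularity, status: under-review] -/
theorem weilFourfoldsSplit_of_reach_of_sigmaDeformsOverEtaleNbhd_of_local_ff_single (hF : weilFamilyReach_hyperbolic)
    (hD : PerfectComplexDeformsOverEtaleNbhd C sigmaAdmissible) {d : ℕ} (hd : 0 < d)
    (P : AbelianVariety ℂ) (ψ₀ : P ⟶ P) (e : ProjectiveEmbedding P.X) (a : complexBetti (projectiveSpace e.n ℂ) 2)
    (hP : P.dim = 2 * 2) (hψ : ψ₀ ≫ ψ₀ = -(d • 𝟙 P)) (ha : IsRationalClass a) (ha0 : a ≠ 0)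
    (hhyp : IsHyperbolicWeilType P ψ₀ 2 (symmetrisedClass d P ψ₀ e a))
    (w : complexBetti P.X (2 * 2)) (hwW : w ∈ weilClassesOf P ψ₀ 2 d) (hwr : IsRationalClass w) (hw0 : w ≠ 0)
    (I : Finset ℕ) (hI : ∀ p : ℕ, 1 ≤ p → p ≤ 2 * 2 → p ∈ I) (E : CochainComplex P.X.left.Modules ℤ)
    (hE : IsBoundedVBComplex E) (a' b' : ℤ) [E.IsStrictlyGE a'] [E.IsStrictlyLE b']
    (hσ : letI := HasDerivedCategory.standard P.X.left.Modules
      HomComplex.IsISemiregularC P.X E a' b' hE.isFiniteLocallyFree {q | q + 1 ∈ I})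
    (q : ℚ) (c : ℕ → ℚ)
    (hch2 : chPerfect C P.X E hE.isFiniteLocallyFree 2 = ((q : ℚ) : ℂ) • cupPowTwo (symmetrisedClass d P ψ₀ e a) 2 + w)
    (hchp : ∀ p ∈ I, p ≠ 2 →
      chPerfect C P.X E hE.isFiniteLocallyFree p = ((c p : ℚ) : ℂ) • cupPowTwo (symmetrisedClass d P ψ₀ e a) p)
    {Y₀ : SchemeOver ℂ} (G₀ : Y₀.left.Modules) :
    letI := HasDerivedCategory.standard Y₀.left.Modules
    letI := HasDerivedCategory.standard P.X.left.Modules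
    ∀ (Φ : DerivedCategory Y₀.left.Modules ⥤ DerivedCategory P.X.left.Modules) [Φ.Additive] [Φ.Linear ℂ]
      [Φ.CommShift ℤ]
      (_ : Φ.obj (DerivedCategory.Q.obj ((CochainComplex.singleFunctor Y₀.left.Modules 0).obj G₀)) ≅
        DerivedCategory.Q.obj E),
      (∀ n : ℤ, n ≤ 0 → Function.Bijective
        (fun f : (DerivedCategory.Q.obj ((CochainComplex.singleFunctor Y₀.left.Modules 0).obj G₀) ⟶
          (DerivedCategory.Q.obj ((CochainComplex.singleFunctor Y₀.left.Modules 0).obj G₀))⟦n⟧) ↦ Φ.map f)) →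
      extRank Y₀ ((CochainComplex.singleFunctor Y₀.left.Modules 0).obj G₀) 0 = 1 →
      Stubs.WeilAlgebraicSplitHyperplane 2 d := by
  intro Φ _ _ _ eΦ hbij h0
  letI := HasDerivedCategory.standard Y₀.left.Modules
  letI := HasDerivedCategory.standard P.X.left.Modules
  exact weilFourfoldsSplit_of_reach_of_sigmaDeformsOverEtaleNbhd_of_extRank_eq hF hD hd P ψ₀ e a hP hψ ha ha0 hhyp w hwW hwr hw0 I
    hI E hE a' b' hσ q c hch2 hchp _ (fun n hn ↦ extRank_eq_of_local_ff _ E Φ eΦ n (hbij n hn))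
    (fun k hk ↦ extRank_single_neg_eq_zero G₀ hk) h0

/-! ## §2 (appended) THE SPLIT MONDAY FORM — the same row with theory seat 3's ONE assumption `hD` replaced by the pair
(F) `PridhamPerfectLifts C` ∧ (E)+(C) `PerfectComplexAlgebraisesLifts C` of `AmplificationChainPridhamPerfect.lean` (`hD` consumed there, §2) -/

/-- **g = 4, σ-TIER, SPLIT TRUST BASE, every by-value binder where the census computed it — the Monday form of record proposed by seat
p7.** BY NAME: `weilFamilyReach_hyperbolic` (Deligne, refereed tree fact); `PridhamPerfectLifts C` (the PRINTED, REFEREED statement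
[Pridham2024Semiregularity] Cor. 2.25 + Rem. 2.27 + Rem. 2.21 + Lemma 1.8–1.9 for strictly perfect complexes, typed VENTURE-side on target
seat 7's real `σ`-carrier `HomComplex.IsISemiregularC` — NOT a Literature fact, undischarged, a hypothesis BY NAME); `PerfectComplexAlgebraisesLifts C`
(HODGE-FREE algebraisation in the printed shape of [Perry2022] Prop. 8.1's proof; kernel-linked to nothing). Theory seat 3's
`PerfectComplexDeformsOverEtaleNbhd C sigmaAdmissible` and target seat 7's `PerfectComplexSigmaTransfer C` are CONSUMED (pair ⟹ `hD` ⟹ `hT`,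
kernel; converses not claimed, W-4). BY VALUE: exactly the binders of `weilFourfoldsSplit_of_reach_of_sigmaDeformsOverEtaleNbhd_of_local_ff_single`
above — the split CM anchor and hyperbolicity (I4), `w ≠ 0` rational in the Weil plane and the Chern data (I3), `I ⊇ {1,2,3,4}`, the bounded
complex of vector bundles `E` on `P.X` in `[a', b']` with `(σ_q(E))_{q+1∈I}` JOINTLY INJECTIVE (`hσ`, the census σ-rank), the SHEAF `G₀ = I_Z`
on `Y₀ = X × X` with `Φ(Q G₀[0]) ≅ Q E`, `Φ.map` bijective on the self-Homs of `Q G₀[0]` in degrees `n ≤ 0` and `extRank Y₀ G₀[0] 0 = 1`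
(«`I_Z` simple», (I1)); `Ext^{<0}(E,E) = 0` is discharged on the SOURCE (a sheaf) and transported by the bijectivity clause. Conclusion:
`Stubs.WeilAlgebraicSplitHyperplane 2 d` (in print: [Markman2023GeneralizedKummers] Thm. 1.5 (= Thm. 13.4; J. Eur. Math. Soc. 25 (2023) p. 236; pre-publication arXiv numbering: Thm. 1.3); re-derived, no new case).
[cite: Markman2023GeneralizedKummers, Theorem 1.5 (= Theorem 13.4), p. 236 (the case in print; arXiv:1805.11574 pre-publication numbering: Theorem 1.3)] [cite: Pridham2024Semiregularity, Cor. 2.25; Rem. 2.27; Rem. 2.21; Lemma 1.8–1.9]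
[cite: Perry2022, proof of Prop. 8.1] [cite: Lieblich2006, Thm. 4.2.1] [cite: BuchweitzFlenner2003, Def. 4.1 and §5 (I-semiregular)]
[cite: Orlov2002DerivedAbelian, Assertion 2.8] [cite: GortzWedhorn2023, Thm. 22.42] [cite: Deligne1982HodgeCycles, proof of Thm. 4.8] -/
theorem weilFourfoldsSplit_of_reach_of_pridhamPerfect_of_algebraisesLifts_of_local_ff_single (hF : weilFamilyReach_hyperbolic)
    (hP : PridhamPerfectLifts C) (hA : PerfectComplexAlgebraisesLifts C) {d : ℕ} (hd : 0 < d)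
    (P : AbelianVariety ℂ) (ψ₀ : P ⟶ P) (e : ProjectiveEmbedding P.X) (a : complexBetti (projectiveSpace e.n ℂ) 2)
    (hP4 : P.dim = 2 * 2) (hψ : ψ₀ ≫ ψ₀ = -(d • 𝟙 P)) (ha : IsRationalClass a) (ha0 : a ≠ 0)
    (hhyp : IsHyperbolicWeilType P ψ₀ 2 (symmetrisedClass d P ψ₀ e a))
    (w : complexBetti P.X (2 * 2)) (hwW : w ∈ weilClassesOf P ψ₀ 2 d) (hwr : IsRationalClass w) (hw0 : w ≠ 0)
    (I : Finset ℕ) (hI : ∀ p : ℕ, 1 ≤ p → p ≤ 2 * 2 → p ∈ I) (E : CochainComplex P.X.left.Modules ℤ)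
    (hE : IsBoundedVBComplex E) (a' b' : ℤ) [E.IsStrictlyGE a'] [E.IsStrictlyLE b']
    (hσ : letI := HasDerivedCategory.standard P.X.left.Modules
      HomComplex.IsISemiregularC P.X E a' b' hE.isFiniteLocallyFree {q | q + 1 ∈ I})
    (q : ℚ) (c : ℕ → ℚ)
    (hch2 : chPerfect C P.X E hE.isFiniteLocallyFree 2 = ((q : ℚ) : ℂ) • cupPowTwo (symmetrisedClass d P ψ₀ e a) 2 + w)
    (hchp : ∀ p ∈ I, p ≠ 2 →
      chPerfect C P.X E hE.isFiniteLocallyFree p = ((c p : ℚ) : ℂ) • cupPowTwo (symmetrisedClass d P ψ₀ e a) p)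
    {Y₀ : SchemeOver ℂ} (G₀ : Y₀.left.Modules) :
    letI := HasDerivedCategory.standard Y₀.left.Modules
    letI := HasDerivedCategory.standard P.X.left.Modules
    ∀ (Φ : DerivedCategory Y₀.left.Modules ⥤ DerivedCategory P.X.left.Modules) [Φ.Additive] [Φ.Linear ℂ]
      [Φ.CommShift ℤ]
      (_ : Φ.obj (DerivedCategory.Q.obj ((CochainComplex.singleFunctor Y₀.left.Modules 0).obj G₀)) ≅
        DerivedCategory.Q.obj E),
      (∀ n : ℤ, n ≤ 0 → Function.Bijective
        (fun f : (DerivedCategory.Q.obj ((CochainComplex.singleFunctor Y₀.left.Modules 0).obj G₀) ⟶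
          (DerivedCategory.Q.obj ((CochainComplex.singleFunctor Y₀.left.Modules 0).obj G₀))⟦n⟧) ↦ Φ.map f)) →
      extRank Y₀ ((CochainComplex.singleFunctor Y₀.left.Modules 0).obj G₀) 0 = 1 →
      Stubs.WeilAlgebraicSplitHyperplane 2 d :=
  weilFourfoldsSplit_of_reach_of_sigmaDeformsOverEtaleNbhd_of_local_ff_single hF
    (perfectComplexDeformsOverEtaleNbhd_sigma_of_pridhamPerfect_of_algebraisesLifts hP hA) hd P ψ₀ e a hP4 hψ ha ha0 hhyp w hwW
    hwr hw0 I hI E hE a' b' hσ q c hch2 hchp G₀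

end Summit.Ventures.HSemireg

end
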